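import Summits.QuantumFields.YangMills.Theorems.BalabanUVNodesN15BackgroundScalarByParts
import Summits.QuantumFields.YangMills.Theorems.BalabanUVNodesN15BackgroundLayerFirstOrderMatrix
import HarnessLib

/-!
# THE BY-PARTS ENTRY-2 DEVICE FOR THE NON-ABELIAN (MATRIX) FIRST-ORDER SPECIES: the right perturbation, the multiplier `M_{C − Σ(∇A)∘e⁻¹}`, the identification
# `E₀∘∇_ν* = E₂∘ι_ν` for M1's pair `bgPairM`, and the matrix coefficient letters (dag-n15-c g8, FILE 12; Track-A node N15 = NE2, s1 «background-layer OPERATOR ingredient»)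

`--kind proof --supports stmt-QuantumFields-20544 --as helper` (K3⁷; count-neutral).  Imports BY NAME this seat's FILE 6 `…N15BackgroundScalarByParts` (through it FILES 1–5:
`fgrad`, `fgradAdj`, `rightPert`, `byPartsMult`, `byPartsFactor`, `e2ByParts`, `E2Unit`, `bopOf`, `krowOf`, `injJ`, `e0_comp_fgradAdj_eq_e2ByParts`,
`projO_bgPropV_fix_right`, `hasMaj_zero_diagK`) and this lineage's g2 M1 `…N15BackgroundLayerFirstOrderMatrix` (through it `MatrixSpecies.mmulOp` ∕ `liftEquiv` ∕
`liftMap` ∕ `liftBlk` ∕ `hasMaj_mmulOp` ∕ `hasMaj_idef_mmulOp`, `PairSpaceMatrix.unstackM` ∕ `bgPairM`, `PairSpace.stack` ∕ `projO`).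

WHAT.  FILE 6 ran the by-parts device on the SCALAR species (coefficients = multiplication operators `M_c`, `M_{a_μ}`).  Here the coefficients are FIBREWISE MATRICES
on the product carrier `X × ι` (colour components `ι`): `M_C f (x, i) = Σ_j C(x)_{ij} f(x, j)` (`mmulOp`), the first-order pair is M1's `bgPairM G D C A = (1 − ĜV̂)⁻¹Ĝ`,
`V̂ = unstackM C A = M_C pr₀ + Σ_μ M_{A_μ} pr_μ` — Bałaban's `V′₁(A)` of (3.52) in coordinates, forward orientation.  §1 algebra: `mmulOp` is additive, intertwines the
lifted translations (`M_A ∘ S_e = S_e ∘ M_{A∘e⁻¹}`, `S_e = pull (liftEquiv e ι)`), and `n(M_A − M_{A∘e⁻¹}) = M_{(∇A)∘e⁻¹}` with the ENTRYWISE quotient `fgradMat`.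
§2 species: `byPartsMult_matrix` (`R̃ = M_{C − Σ_μ(∇_μA_μ)∘e_μ⁻¹}`), `unstackM_comp_stack_eq_rightPert`, ★ `projO_bgPairM_fix_right` (the RIGHT (3.65) for `pr₀∘bgPairM`),
★★ `e0_comp_fgradAdj_eq_e2ByParts_matrix` (IDENTIFICATION: `E₀∘∇_ν* = e2ByParts B̂ K̂ ∘ ι_ν`, NO mixed piece).  §3 letters: `M_{A∘e⁻¹} ≤ diagK r`, the multiplier
`≤ diagK (r + |J|r₁)` from row sums of `C` and of `∇_μA_μ`, its η-defect `≤ diagK (o + |J|o)` from row fits, the translated-coefficient defect, the one-step oscillation.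

HONEST FRAMING.  Algebra and bookkeeping for the matrix species; the coefficient matrices `C`, `A_μ` are FREE data here (their derivation from a gauge field —
g2 `…V1Coefficients` — and the backward orientation `J ⊕ J` are the sequel's); nothing about Bałaban's `G(U)` asserted; N15 not discharged; nothing continuum ∕ OS ∕
mass-gap ∕ Clay.
-/

noncomputable section

open scoped BigOperators
open Finset

namespace Summit.QuantumFields.YangMills.BalabanUVNodes.N15.BackgroundLayer

open Literature.MathematicalPhysics.QuantumFieldTheory.Balaban1983to89
open Literature.MathematicalPhysics.QuantumFieldTheory.Balaban1983to89.B11SectG (BlockNorm HasMaj hasMaj_zero)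
open Literature.MathematicalPhysics.QuantumFieldTheory.Balaban1983to89.T4EtaRateDefect (idef idef_apply idef_zero)
open Literature.MathematicalPhysics.QuantumFieldTheory.Balaban1983to89.T4EtaRateCoeffDefect (pull pull_apply diagK diagK_nonneg)
open Summit.QuantumFields.YangMills.BalabanUVNodes.N15.MatrixSpecies (mmulOp mmulOp_apply liftEquiv liftEquiv_apply liftEquiv_symm_apply liftMap liftBlk hasMaj_mmulOp
  hasMaj_idef_mmulOp)

variable {d : ℕ}

/-! ## §1 Matrix multiplication operators: additivity, the translation intertwiner, the entrywise quotient -/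

section Algebra

variable {X ι J : Type} [Fintype ι] [DecidableEq ι]

/-- THE ENTRYWISE FORWARD DIFFERENCE QUOTIENT of a matrix field: `(∇A)(x) = n·(A(e x) − A(x))`. [cite: Balaban1985BackgroundPropagators, (3.35) p.396 (shape)] -/
def fgradMat (n : ℝ) (e : X ≃ X) (A : X → Matrix ι ι ℝ) : X → Matrix ι ι ℝ := fun x => n • (A (e x) - A x)

omit [Fintype ι] [DecidableEq ι] in
/-- Its entries are the scalar quotients of the entries. [folklore] -/
theorem fgradMat_apply (n : ℝ) (e : X ≃ X) (A : X → Matrix ι ι ℝ) (x : X) (i j : ι) :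
    fgradMat n e A x i j = fgrad n e (fun x => A x i j) x := by
  rw [fgradMat, fgrad_apply, Matrix.smul_apply, Matrix.sub_apply, smul_eq_mul]

omit [DecidableEq ι] in
/-- `mmulOp` is additive: `M_{C − C′} = M_C − M_{C′}`. [folklore] -/
theorem mmulOp_sub (C C' : X → Matrix ι ι ℝ) : mmulOp (C - C') = mmulOp C - mmulOp C' := by
  refine LinearMap.ext fun f => funext fun p => ?_
  simp only [mmulOp_apply, LinearMap.sub_apply, Pi.sub_apply, Matrix.sub_apply, sub_mul, Finset.sum_sub_distrib]

omit [DecidableEq ι] in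
/-- `mmulOp` of a finite sum. [folklore] -/
theorem mmulOp_sum [Fintype J] (A : J → X → Matrix ι ι ℝ) : mmulOp (∑ μ, A μ) = ∑ μ, mmulOp (A μ) := by
  refine LinearMap.ext fun f => funext fun p => ?_
  simp only [mmulOp_apply, LinearMap.sum_apply, Finset.sum_apply, Matrix.sum_apply, Finset.sum_mul]
  rw [Finset.sum_comm]

omit [DecidableEq ι] in
/-- THE TRANSLATION INTERTWINER: `M_A ∘ S_e = S_e ∘ M_{A∘e⁻¹}` for the lifted translation `S_e = pull (liftEquiv e ι)`. [folklore] -/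
theorem mmulOp_comp_pull (A : X → Matrix ι ι ℝ) (e : X ≃ X) :
    mmulOp A ∘ₗ pull (liftEquiv e ι) = pull (liftEquiv e ι) ∘ₗ mmulOp (A ∘ e.symm) := by
  refine LinearMap.ext fun f => funext fun p => ?_
  simp only [LinearMap.comp_apply, mmulOp_apply, pull_apply, liftEquiv_apply, Function.comp_apply, Equiv.symm_apply_apply]

omit [DecidableEq ι] in
/-- The same read as `S_e ∘ M_{A∘e⁻¹} = M_A ∘ S_e`. [folklore] -/
theorem pull_comp_mmulOp_translate (A : X → Matrix ι ι ℝ) (e : X ≃ X) :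
    pull (liftEquiv e ι) ∘ₗ mmulOp (A ∘ e.symm) = mmulOp A ∘ₗ pull (liftEquiv e ι) :=
  (mmulOp_comp_pull A e).symm

omit [DecidableEq ι] in
/-- THE LEIBNIZ REMAINDER AS A MULTIPLICATION: `n·(M_A − M_{A∘e⁻¹}) = M_{(∇A)∘e⁻¹}`. [folklore] -/
theorem smul_mmulOp_sub_eq (n : ℝ) (e : X ≃ X) (A : X → Matrix ι ι ℝ) : n • (mmulOp A - mmulOp (A ∘ e.symm)) = mmulOp (fgradMat n e A ∘ e.symm) := by
  refine LinearMap.ext fun f => funext fun p => ?_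
  simp only [LinearMap.smul_apply, LinearMap.sub_apply, Pi.smul_apply, Pi.sub_apply, mmulOp_apply, Function.comp_apply, fgradMat, Equiv.apply_symm_apply,
    Matrix.smul_apply, Matrix.sub_apply, smul_eq_mul, Finset.mul_sum, ← Finset.sum_sub_distrib]
  exact Finset.sum_congr rfl fun j _ => by ring

end Algebra

/-! ## §2 The matrix species: by-parts multiplier, right perturbation, the RIGHT (3.65), the identification -/

section Species

variable {X ι J : Type} [Fintype ι] [Fintype J] (τ : J → X ≃ X) (n : ℝ) (G : (X × ι → ℝ) →ₗ[ℝ] (X × ι → ℝ))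
  (C : X → Matrix ι ι ℝ) (A : J → X → Matrix ι ι ℝ)

/-- THE BY-PARTS MULTIPLIER OF THE MATRIX SPECIES: `R̃ = M_{C − Σ_μ (∇_μA_μ)∘e_μ⁻¹}` (forward orientation, no backward coefficient). [cite: Balaban1985BackgroundPropagators, (3.52) p.400 (shape); by-parts form ours] -/
theorem byPartsMult_matrix :
    byPartsMult n (mmulOp C) (fun μ => mmulOp (A μ)) (fun μ => mmulOp (A μ ∘ ⇑(τ μ).symm)) (fun _ => 0) (fun _ => 0) =
      mmulOp (C - ∑ μ, fgradMat n (τ μ) (A μ) ∘ ⇑(τ μ).symm) := by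
  rw [byPartsMult, mmulOp_sub, mmulOp_sum]
  congr 1
  refine Finset.sum_congr rfl fun μ _ => ?_
  rw [sub_zero, add_zero, smul_mmulOp_sub_eq]

/-- THE RIGHT PERTURBATION OF THE MATRIX SPECIES IS M1's UNSTACKED PERTURBATION AFTER THE STACK: `W = V̂∘Ĝ = M_CG + Σ_μ M_{A_μ}∇_μG` when the derived pieces ARE the
forward derivatives of the piece along the lifted translations. [cite: Balaban1985BackgroundPropagators, (3.52) p.400, (3.63)–(3.64) p.402 (shapes)] -/
theorem unstackM_comp_stack_eq_rightPert {D : J → (X × ι → ℝ) →ₗ[ℝ] (X × ι → ℝ)} (hD : ∀ μ, D μ = fgrad n (liftEquiv (τ μ) ι) ∘ₗ G) :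
    unstackM C A ∘ₗ stack G D = rightPert (fun μ => liftEquiv (τ μ) ι) n G (mmulOp C) (fun μ => mmulOp (A μ)) (fun _ => 0) := by
  rw [unstackM, rightPert, LinearMap.add_comp, linearMap_sum_comp, LinearMap.comp_assoc, projO_none_comp_stack]
  congr 1
  refine Finset.sum_congr rfl fun μ _ => ?_
  rw [LinearMap.comp_assoc, projO_some_comp_stack, hD μ, LinearMap.zero_comp, add_zero]

variable [Fintype X] [DecidableEq X] [DecidableEq ι] [DecidableEq J]

/-- ★ **`hE0` FOR M1's NON-ABELIAN PAIR**: the dressed entry 0 `E₀ = pr₀X̂`, `X̂ = bgPairM G D C A`, solves the RIGHT fixed-point equation of FILE 1's `e2_closed_system` with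
the matrix species data, whenever the derived pieces are the forward derivatives of `G` and `1 − [ĜV̂]` is a unit (FILE 5 `projO_bgPropV_fix_right`).
[cite: Balaban1985BackgroundPropagators, (3.64)–(3.65) p.402 (mechanism)] -/
theorem projO_bgPairM_fix_right {D : J → (X × ι → ℝ) →ₗ[ℝ] (X × ι → ℝ)} (hD : ∀ μ, D μ = fgrad n (liftEquiv (τ μ) ι) ∘ₗ G)
    (hunit : IsUnit (1 - LinearMap.toMatrix' (stack G D ∘ₗ unstackM C A))) :
    projO none ∘ₗ bgPairM G D C A =
      G + (projO none ∘ₗ bgPairM G D C A) ∘ₗ rightPert (fun μ => liftEquiv (τ μ) ι) n G (mmulOp C) (fun μ => mmulOp (A μ)) (fun _ => 0) := by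
  rw [← unstackM_comp_stack_eq_rightPert τ n G C A hD, bgPairM]
  exact projO_bgPropV_fix_right hunit

/-- ★★ **IDENTIFICATION FOR THE MATRIX SPECIES**: under the unit hypotheses, the by-parts entry-2 object built on `S_ν = G∇_ν*` (`∇_ν* = fgradAdj n (liftEquiv e_ν ι)`),
`E₀ = pr₀(bgPairM G D C A)`, the multiplier `M_{C − Σ(∇A)∘e⁻¹}` and the rows `S_μM_{A_μ∘e⁻¹}` IS `E₀∘∇_ν*` — the non-abelian dressed propagator composed with `∇_ν*`;
no mixed piece `∇_μG∇_ν*` is a letter of the right-hand side. [cite: Balaban1985BackgroundPropagators, (3.64)–(3.65) p.402 (mechanism); by-parts form ours] -/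
theorem e0_comp_fgradAdj_eq_e2ByParts_matrix {D : J → (X × ι → ℝ) →ₗ[ℝ] (X × ι → ℝ)} (hD : ∀ μ, D μ = fgrad n (liftEquiv (τ μ) ι) ∘ₗ G)
    (hunit : IsUnit (1 - LinearMap.toMatrix' (stack G D ∘ₗ unstackM C A)))
    (hunit2 : E2Unit (krowOf (fun ν => G ∘ₗ fgradAdj n (liftEquiv (τ ν) ι)) (fun μ => pull (liftEquiv (τ μ) ι)) (fun μ => mmulOp (A μ ∘ ⇑(τ μ).symm))
      (fun _ => 0))) (ν : J) :
    (projO none ∘ₗ bgPairM G D C A) ∘ₗ fgradAdj n (liftEquiv (τ ν) ι) =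
      e2ByParts (bopOf (fun ν => G ∘ₗ fgradAdj n (liftEquiv (τ ν) ι)) (projO none ∘ₗ bgPairM G D C A)
          (mmulOp (C - ∑ μ, fgradMat n (τ μ) (A μ) ∘ ⇑(τ μ).symm)))
        (krowOf (fun ν => G ∘ₗ fgradAdj n (liftEquiv (τ ν) ι)) (fun μ => pull (liftEquiv (τ μ) ι)) (fun μ => mmulOp (A μ ∘ ⇑(τ μ).symm)) (fun _ => 0)) ∘ₗ
        injJ ν := by
  rw [← byPartsMult_matrix τ n C A]
  exact e0_comp_fgradAdj_eq_e2ByParts (projO_bgPairM_fix_right τ n G C A hD hunit) (fun μ => mmulOp_comp_pull (A μ) (τ μ))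
    (fun μ => by rw [LinearMap.zero_comp, LinearMap.comp_zero]) hunit2 ν

end Species

/-! ## §3 The matrix coefficient letters (row sums and row fits) -/

section Letters

variable {X X' ι J : Type} [Fintype X] [Fintype X'] [Fintype ι] [DecidableEq ι] [Fintype J] [DecidableEq J] {g : B6.Geometry} (blk : X → g.Site) (π : X' → X)
variable {τ : J → X ≃ X} {τ' : J → X' ≃ X'} {n n' : ℝ} {C : X → Matrix ι ι ℝ} {A : J → X → Matrix ι ι ℝ} {C' : X' → Matrix ι ι ℝ} {A' : J → X' → Matrix ι ι ℝ}
  {r r₁ o o₁ : ℝ}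

omit [Fintype X'] [Fintype J] [DecidableEq J] [DecidableEq ι] in
/-- translated coefficient: `M_{A∘e⁻¹} ≤ diagK r` from the row sums `Σ_j |A_{ij}| ≤ r`. [folklore] -/
theorem hasMaj_mmulOp_translate (hr : 0 ≤ r) (hA : ∀ μ x i, ∑ j, |A μ x i j| ≤ r) (μ : J) :
    HasMaj (BlockNorm.ofBlocks g (liftBlk blk ι)) (BlockNorm.ofBlocks g (liftBlk blk ι)) (mmulOp (A μ ∘ ⇑(τ μ).symm)) (diagK fun _ => r) :=
  hasMaj_mmulOp blk (fun _ => hr) fun x i => hA μ ((τ μ).symm x) i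

omit [Fintype X'] [DecidableEq J] [DecidableEq ι] in
/-- THE BY-PARTS MULTIPLIER `M_{C − Σ(∇A)∘e⁻¹} ≤ diagK (r + |J|·r₁)` from the row sums of `C` (`≤ r`) and of the GRADIENTS `∇_μA_μ` (`≤ r₁`). [folklore] -/
theorem hasMaj_byPartsMult_matrix (hr : 0 ≤ r) (hr₁ : 0 ≤ r₁) (hC : ∀ x i, ∑ j, |C x i j| ≤ r) (hgA : ∀ μ x i, ∑ j, |fgradMat n (τ μ) (A μ) x i j| ≤ r₁) :
    HasMaj (BlockNorm.ofBlocks g (liftBlk blk ι)) (BlockNorm.ofBlocks g (liftBlk blk ι)) (mmulOp (C - ∑ μ, fgradMat n (τ μ) (A μ) ∘ ⇑(τ μ).symm))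
      (diagK fun _ => r + Fintype.card J * r₁) := by
  refine hasMaj_mmulOp blk (fun _ => by positivity) fun x i => ?_
  calc ∑ j, |(C - ∑ μ, fgradMat n (τ μ) (A μ) ∘ ⇑(τ μ).symm) x i j|
      ≤ ∑ j, (|C x i j| + ∑ μ, |fgradMat n (τ μ) (A μ) ((τ μ).symm x) i j|) := Finset.sum_le_sum fun j _ => by
        rw [Pi.sub_apply, Matrix.sub_apply, Finset.sum_apply, Matrix.sum_apply]
        refine (abs_sub _ _).trans (add_le_add le_rfl ?_)
        exact Finset.abs_sum_le_sum_abs _ _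
    _ = ∑ j, |C x i j| + ∑ μ, ∑ j, |fgradMat n (τ μ) (A μ) ((τ μ).symm x) i j| := by rw [Finset.sum_add_distrib, Finset.sum_comm]
    _ ≤ r + ∑ _μ : J, r₁ := add_le_add (hC x i) (Finset.sum_le_sum fun μ _ => hgA μ _ i)
    _ = r + Fintype.card J * r₁ := by rw [Finset.sum_const, Finset.card_univ, nsmul_eq_mul]

omit [DecidableEq J] [DecidableEq ι] in
/-- ITS η-DEFECT `≤ diagK (o + |J|·o)` from the row fits `Σ_j |C′ − C∘π| ≤ o` and `Σ_j |(∇′A′)∘e′⁻¹ − ((∇A)∘e⁻¹)∘π| ≤ o`. [folklore] -/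
theorem hasMaj_idef_byPartsMult_matrix (ho : 0 ≤ o) (hfC : ∀ x' i, ∑ j, |C' x' i j - C (π x') i j| ≤ o)
    (hfg : ∀ μ x' i, ∑ j, |fgradMat n' (τ' μ) (A' μ) ((τ' μ).symm x') i j - fgradMat n (τ μ) (A μ) ((τ μ).symm (π x')) i j| ≤ o) :
    HasMaj (BlockNorm.ofBlocks g (liftBlk blk ι)) (BlockNorm.ofBlocks g (liftBlk (blk ∘ π) ι))
      (idef (pull (liftMap π ι)) (pull (liftMap π ι)) (mmulOp (C' - ∑ μ, fgradMat n' (τ' μ) (A' μ) ∘ ⇑(τ' μ).symm))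
        (mmulOp (C - ∑ μ, fgradMat n (τ μ) (A μ) ∘ ⇑(τ μ).symm)))
      (diagK fun _ => o + Fintype.card J * o) := by
  refine hasMaj_idef_mmulOp blk π (fun _ => by positivity) fun x' i => ?_
  calc ∑ j, |(C' - ∑ μ, fgradMat n' (τ' μ) (A' μ) ∘ ⇑(τ' μ).symm) x' i j - (C - ∑ μ, fgradMat n (τ μ) (A μ) ∘ ⇑(τ μ).symm) (π x') i j|
      ≤ ∑ j, (|C' x' i j - C (π x') i j| +
          ∑ μ, |fgradMat n' (τ' μ) (A' μ) ((τ' μ).symm x') i j - fgradMat n (τ μ) (A μ) ((τ μ).symm (π x')) i j|) :=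
        Finset.sum_le_sum fun j _ => by
          rw [Pi.sub_apply, Pi.sub_apply, Matrix.sub_apply, Matrix.sub_apply, Finset.sum_apply, Finset.sum_apply, Matrix.sum_apply, Matrix.sum_apply,
            sub_sub_sub_comm, ← Finset.sum_sub_distrib]
          refine (abs_sub _ _).trans (add_le_add le_rfl ?_)
          exact Finset.abs_sum_le_sum_abs _ _
    _ = ∑ j, |C' x' i j - C (π x') i j| +
          ∑ μ, ∑ j, |fgradMat n' (τ' μ) (A' μ) ((τ' μ).symm x') i j - fgradMat n (τ μ) (A μ) ((τ μ).symm (π x')) i j| := by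
        rw [Finset.sum_add_distrib, Finset.sum_comm]
    _ ≤ o + ∑ _μ : J, o := add_le_add (hfC x' i) (Finset.sum_le_sum fun μ _ => hfg μ x' i)
    _ = o + Fintype.card J * o := by rw [Finset.sum_const, Finset.card_univ, nsmul_eq_mul]

omit [Fintype J] [DecidableEq J] [DecidableEq ι] in
/-- THE η-DEFECT OF THE TRANSLATED COEFFICIENTS `≤ diagK o` from the translated row fit `Σ_j |A′(e′⁻¹x′) − A(e⁻¹(πx′))| ≤ o`. [folklore] -/
theorem hasMaj_idef_mmulOp_translate (μ : J) (ho : 0 ≤ o) (hfA : ∀ x' i, ∑ j, |A' μ ((τ' μ).symm x') i j - A μ ((τ μ).symm (π x')) i j| ≤ o) :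
    HasMaj (BlockNorm.ofBlocks g (liftBlk blk ι)) (BlockNorm.ofBlocks g (liftBlk (blk ∘ π) ι))
      (idef (pull (liftMap π ι)) (pull (liftMap π ι)) (mmulOp (A' μ ∘ ⇑(τ' μ).symm)) (mmulOp (A μ ∘ ⇑(τ μ).symm))) (diagK fun _ => o) :=
  hasMaj_idef_mmulOp blk π (fun _ => ho) fun x' i => hfA x' i

omit [Fintype X] [Fintype X'] [Fintype J] [DecidableEq J] [DecidableEq ι] in
/-- THE COARSE SHIFT INTERTWINER of the translated coefficient: `S_μ ∘ M_{A_μ∘e_μ⁻¹} = M_{A_μ} ∘ S_μ`. [folklore] -/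
theorem pull_comp_mmulOp_translate' (μ : J) : pull (liftEquiv (τ μ) ι) ∘ₗ mmulOp (A μ ∘ ⇑(τ μ).symm) = mmulOp (A μ) ∘ₗ pull (liftEquiv (τ μ) ι) :=
  pull_comp_mmulOp_translate (A μ) (τ μ)

omit [Fintype X'] [Fintype J] [DecidableEq J] [DecidableEq ι] in
/-- THE ONE-STEP OSCILLATION LETTER: `M_{A_μ} − M_{A_μ∘e_μ⁻¹} ≤ diagK o₁` from the row oscillation `Σ_j |A_μ(x) − A_μ(e_μ⁻¹x)| ≤ o₁`. [folklore] -/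
theorem hasMaj_mmulOp_sub_translate (μ : J) (ho₁ : 0 ≤ o₁) (hosc : ∀ x i, ∑ j, |A μ x i j - A μ ((τ μ).symm x) i j| ≤ o₁) :
    HasMaj (BlockNorm.ofBlocks g (liftBlk blk ι)) (BlockNorm.ofBlocks g (liftBlk blk ι)) (mmulOp (A μ) - mmulOp (A μ ∘ ⇑(τ μ).symm)) (diagK fun _ => o₁) := by
  rw [← mmulOp_sub]
  exact hasMaj_mmulOp blk (fun _ => ho₁) fun x i => by simpa only [Pi.sub_apply, Matrix.sub_apply, Function.comp_apply] using hosc x i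

omit [Fintype X] [Fintype X'] [Fintype J] [DecidableEq J] [DecidableEq ι] in
/-- the row oscillation from the row sums of the gradient: `Σ_j |A(x) − A(e⁻¹x)| = Σ_j |∇A(e⁻¹x)|∕n ≤ r₁∕n` (`n > 0`). [folklore] -/
theorem rowOsc_of_fgradMat (μ : J) (hn : 0 < n) (hgA : ∀ x i, ∑ j, |fgradMat n (τ μ) (A μ) x i j| ≤ r₁) (x : X) (i : ι) :
    ∑ j, |A μ x i j - A μ ((τ μ).symm x) i j| ≤ r₁ / n := by
  have h := hgA ((τ μ).symm x) i
  rw [le_div_iff₀ hn, Finset.sum_mul]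
  refine le_trans (le_of_eq (Finset.sum_congr rfl fun j _ => ?_)) h
  rw [fgradMat, Equiv.apply_symm_apply, Matrix.smul_apply, Matrix.sub_apply, smul_eq_mul, abs_mul, abs_of_pos hn, mul_comm]

end Letters

end Summit.QuantumFields.YangMills.BalabanUVNodes.N15.BackgroundLayer

end
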